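import Mathlib
import Summits.MatrixMultiplication.MatrixMultiplication.Theorems.SnSubsetDichotomyHyperoctahedralSubsetsCycleCount

/-!
# `SnSubsetDichotomy.HyperoctahedralSubsets`, line `spherical-rank-sieve` — the ALTERNATING-CYCLE SUPPLY

Helper for crux `stmt-MatrixMultiplication-8305` (lead c1).  The composition of the line
(`Cruxes/HyperoctahedralSubsets/Lines/spherical_rank_sieve.lean`) feeds SUPPORT-DISJOINT COMMUTING LOCAL
TRIPLES — pairs `(a, b)` of commuting involutions, not both trivial, with `a ∈ C(μ 0)`, `b ∈ C(μ 1)`,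
`ab ∈ C(μ 2)` — into the landed bridge `stub_triplesToGroup` (p79923) and the group-packing lemma
(p74548).  The cheapest supply of such triples is the component structure of the 2-factors
`M_i ∪ M_j` of the 3-edge-coloured cubic graph `M₀ ∪ M₁ ∪ M₂` (`M_c` = the perfect matching of the
fixed-point-free involution `μ c`): every component (alternating cycle, digons included) carries a
fixed-point-free colour-preserving involution, i.e. a permutation `r ≠ 1`, `r² = 1`, commuting with
`μ i` and `μ j` and supported on the component.  This file proves that supply in the exact input
format of `stub_triplesToGroup`:

* `exists_commuting_involution_on` — for fixed-point-free involutions `σ, τ` of a finite type and a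
  non-empty finite set `S` closed under `σ` and `τ`, there is an involution `r ≠ 1` commuting with
  `σ` and `τ` whose support lies in `S`.  Construction: pick `v₀ ∈ S`, put `π := στ` (so
  `σπσ⁻¹ = π⁻¹`); the `π`-cycles `A ∋ v₀` and `B = σA ∋ σv₀` are distinct
  (`CycleCount.not_sameCycle_apply`), and `r` is the `π`-equivariant swap `A ↔ B` with
  `r(π^t v₀) = π^t(σ v₀)` — well defined because `π^k` fixes `σ v₀` iff it fixes `v₀`.
* `stub_altCycleSupply` — for `i ≠ j` and `g` pairwise-disjoint non-empty `⟨μ i, μ j⟩`-closed sets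
  `S l`, there are `g` support-disjoint commuting local triples with supports inside the `S l`
  (roles: `(r, r)` for `{i,j} = {0,1}`, `(r, 1)` for `{0,2}`, `(1, r)` for `{1,2}`).

In particular the number of components of any 2-factor `M_i ∪ M_j` is a lower bound for the number
of support-disjoint local triples, so the open core of the line may assume that all three 2-factors
have few (`< c√n`) components.  References: the reduction is this line's (lead -0 NOTES §2, "(S1)
supply"); the dihedral bookkeeping follows the landed `CycleCount` file. [folklore]
-/

-- the project's summit namespace `Summit.MatrixMultiplication.MatrixMultiplication` repeats a component by design (D-0022)
set_option linter.dupNamespace false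

namespace Summit.MatrixMultiplication.MatrixMultiplication.Theorems.HyperoctahedralSubsets

open Equiv Equiv.Perm

namespace AltCycleSupply

variable {α : Type*}

/-- For a permutation `π` and a point `x`: `π^i x = π^t x ↔ π^(i - t) x = x`. [folklore] -/
theorem zpow_apply_eq_zpow_apply_iff (π : Perm α) (x : α) (i t : ℤ) :
    (π ^ i) x = (π ^ t) x ↔ (π ^ (i - t)) x = x := by
  rw [show i - t = -t + i by ring, zpow_add, Perm.mul_apply, zpow_neg, Perm.inv_eq_iff_eq]

/-- **The commuting involution on one alternating component.**  Let `σ, τ` be fixed-point-free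
involutions of a finite type and `S` a non-empty finite set closed under `σ` and `τ`.  Then some
involution `r ≠ 1` commutes with `σ` and `τ` and moves only points of `S`.  (With `π = στ`,
`r` is the `π`-equivariant swap of the `π`-cycle of a point `v₀ ∈ S` with the `π`-cycle of
`σ v₀`, sending `π^t v₀ ↦ π^t (σ v₀)`; it is the reflection of the alternating cycle of
`M_σ ∪ M_τ` through `v₀` in the midpoint of the edge `{v₀, σ v₀}`.) [folklore] -/
theorem exists_commuting_involution_on [Fintype α] [DecidableEq α] (σ τ : Perm α)
    (hσ : σ * σ = 1) (hτ : τ * τ = 1) (fσ : ∀ v, σ v ≠ v) (fτ : ∀ v, τ v ≠ v)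
    (S : Finset α) (hS : ∀ v ∈ S, σ v ∈ S ∧ τ v ∈ S) (hne : S.Nonempty) :
    ∃ r : Perm α, r * r = 1 ∧ r ≠ 1 ∧ r * σ = σ * r ∧ r * τ = τ * r ∧ ∀ v, r v ≠ v → v ∈ S := by
  classical
  obtain ⟨v₀, hv₀⟩ := hne
  set π : Perm α := σ * τ with hπ_def
  -- involution bookkeeping
  have hσinv : σ⁻¹ = σ := inv_eq_iff_mul_eq_one.2 hσ
  have hτinv : τ⁻¹ = τ := inv_eq_iff_mul_eq_one.2 hτ
  have hσσ : ∀ y, σ (σ y) = y := fun y => by rw [← Perm.mul_apply, hσ, Perm.one_apply]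
  have hc : σ * π * σ⁻¹ = π⁻¹ := by
    rw [hπ_def, mul_inv_rev, hσinv, hτinv, ← mul_assoc, hσ, one_mul]
  have hτπ : τ = σ * π := by rw [hπ_def, ← mul_assoc, hσ, one_mul]
  have h2 : ∀ y, π y ≠ σ y := fun y h => fτ y (σ.injective (by simpa [hπ_def] using h))
  -- `σ` conjugates `π^k` to `π^(-k)`
  have key : ∀ (k : ℤ) (z : α), σ ((π ^ k) z) = (π ^ (-k)) (σ z) := fun k z => by
    have e : σ * π ^ k * σ⁻¹ = π ^ (-k) := by rw [← conj_zpow, hc, inv_zpow, zpow_neg]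
    rw [← e]
    simp [Perm.coe_mul, hσinv, hσσ]
  have key' : ∀ (k : ℤ), (π ^ k) (σ v₀) = σ ((π ^ (-k)) v₀) := fun k => by
    rw [key, neg_neg]
  -- `π^k` fixes `σ v₀` iff it fixes `v₀`
  have hper : ∀ k : ℤ, (π ^ k) (σ v₀) = σ v₀ ↔ (π ^ k) v₀ = v₀ := fun k => by
    rw [key', σ.injective.eq_iff, zpow_neg, Perm.inv_eq_iff_eq, eq_comm]
  have transA : ∀ i t : ℤ, (π ^ i) v₀ = (π ^ t) v₀ → (π ^ i) (σ v₀) = (π ^ t) (σ v₀) :=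
    fun i t h => by
      rw [zpow_apply_eq_zpow_apply_iff] at h ⊢
      exact (hper _).2 h
  have transB : ∀ i t : ℤ, (π ^ i) (σ v₀) = (π ^ t) (σ v₀) → (π ^ i) v₀ = (π ^ t) v₀ :=
    fun i t h => by
      rw [zpow_apply_eq_zpow_apply_iff] at h ⊢
      exact (hper _).1 h
  -- the two `π`-cycles of the component are distinct
  have hAB : ¬ π.SameCycle v₀ (σ v₀) :=
    CycleCount.not_sameCycle_apply hc fσ h2 v₀
  have hAB' : ∀ t : ℤ, ¬ π.SameCycle v₀ ((π ^ t) (σ v₀)) := fun t h =>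
    hAB (sameCycle_zpow_right.1 h)
  have hBA' : ∀ t : ℤ, ¬ π.SameCycle (σ v₀) ((π ^ t) v₀) := fun t h =>
    hAB (sameCycle_zpow_right.1 h).symm
  -- the swap, as a function
  set f : α → α := fun y =>
    if h : π.SameCycle v₀ y then (π ^ (Classical.choose h)) (σ v₀)
    else if h' : π.SameCycle (σ v₀) y then (π ^ (Classical.choose h')) v₀ else y with hf_def
  have fA : ∀ t : ℤ, f ((π ^ t) v₀) = (π ^ t) (σ v₀) := fun t => by
    have h : π.SameCycle v₀ ((π ^ t) v₀) := ⟨t, rfl⟩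
    have e : f ((π ^ t) v₀) = (π ^ (Classical.choose h)) (σ v₀) := by
      simp only [hf_def, dif_pos h]
    rw [e]
    exact transA _ _ (Classical.choose_spec h)
  have fB : ∀ t : ℤ, f ((π ^ t) (σ v₀)) = (π ^ t) v₀ := fun t => by
    have h : ¬ π.SameCycle v₀ ((π ^ t) (σ v₀)) := hAB' t
    have h' : π.SameCycle (σ v₀) ((π ^ t) (σ v₀)) := ⟨t, rfl⟩
    have e : f ((π ^ t) (σ v₀)) = (π ^ (Classical.choose h')) v₀ := by
      simp only [hf_def, dif_neg h, dif_pos h']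
    rw [e]
    exact transB _ _ (Classical.choose_spec h')
  have fC : ∀ y, ¬ π.SameCycle v₀ y → ¬ π.SameCycle (σ v₀) y → f y = y := fun y h h' => by
    simp only [hf_def, dif_neg h, dif_neg h']
  -- trichotomy of points
  have cases3 : ∀ y, (∃ t : ℤ, y = (π ^ t) v₀) ∨ (∃ t : ℤ, y = (π ^ t) (σ v₀)) ∨
      (¬ π.SameCycle v₀ y ∧ ¬ π.SameCycle (σ v₀) y) := fun y => by
    by_cases h : π.SameCycle v₀ y
    · obtain ⟨t, ht⟩ := h; exact Or.inl ⟨t, ht.symm⟩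
    · by_cases h' : π.SameCycle (σ v₀) y
      · obtain ⟨t, ht⟩ := h'; exact Or.inr (Or.inl ⟨t, ht.symm⟩)
      · exact Or.inr (Or.inr ⟨h, h'⟩)
  have hinv : Function.Involutive f := fun y => by
    rcases cases3 y with ⟨t, rfl⟩ | ⟨t, rfl⟩ | ⟨h, h'⟩
    · rw [fA, fB]
    · rw [fB, fA]
    · rw [fC y h h', fC y h h']
  set r : Perm α := hinv.toPerm f with hr_def
  have hr : ∀ y, r y = f y := fun y => rfl
  -- invariance of the complement
  have hcompπ : ∀ y, ¬ π.SameCycle v₀ y → ¬ π.SameCycle (σ v₀) y →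
      ¬ π.SameCycle v₀ (π y) ∧ ¬ π.SameCycle (σ v₀) (π y) := fun y h h' =>
    ⟨fun k => h (sameCycle_apply_right.1 k), fun k => h' (sameCycle_apply_right.1 k)⟩
  have hcompσ : ∀ y, ¬ π.SameCycle v₀ y → ¬ π.SameCycle (σ v₀) y →
      ¬ π.SameCycle v₀ (σ y) ∧ ¬ π.SameCycle (σ v₀) (σ y) := fun y h h' => by
    constructor
    · rintro ⟨t, ht⟩
      apply h'
      refine ⟨-t, ?_⟩
      have := congrArg σ ht
      rw [hσσ, key] at this
      exact this
    · rintro ⟨t, ht⟩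
      apply h
      refine ⟨-t, ?_⟩
      have := congrArg σ ht
      rw [hσσ, key, hσσ] at this
      exact this
  have hσr : r * σ = σ * r := by
    ext y
    simp only [Perm.coe_mul, Function.comp_apply, hr]
    rcases cases3 y with ⟨t, rfl⟩ | ⟨t, rfl⟩ | ⟨h, h'⟩
    · rw [key, fB, fA, key', hσσ]
    · rw [key, hσσ, fA, fB, key', neg_neg]
    · obtain ⟨k, k'⟩ := hcompσ y h h'
      rw [fC _ k k', fC y h h']
  have hπr : r * π = π * r := by
    ext y
    simp only [Perm.coe_mul, Function.comp_apply, hr]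
    rcases cases3 y with ⟨t, rfl⟩ | ⟨t, rfl⟩ | ⟨h, h'⟩
    · rw [← Perm.mul_apply, ← zpow_one_add, fA, fA, zpow_one_add, Perm.mul_apply]
    · rw [← Perm.mul_apply, ← zpow_one_add, fB, fB, zpow_one_add, Perm.mul_apply]
    · obtain ⟨k, k'⟩ := hcompπ y h h'
      rw [fC _ k k', fC y h h']
  refine ⟨r, ?_, ?_, hσr, ?_, ?_⟩
  · -- involution
    ext y
    simp [hr, hinv y]
  · -- nontrivial: `r v₀ = σ v₀ ≠ v₀`
    intro h1
    have e : r v₀ = σ v₀ := by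
      rw [hr]; simpa using fA 0
    rw [h1, Perm.one_apply] at e
    exact fσ v₀ e.symm
  · -- commutes with `τ = σπ`
    rw [hτπ]
    calc r * (σ * π) = (r * σ) * π := (mul_assoc _ _ _).symm
      _ = (σ * r) * π := by rw [hσr]
      _ = σ * (r * π) := mul_assoc _ _ _
      _ = σ * (π * r) := by rw [hπr]
      _ = σ * π * r := (mul_assoc _ _ _).symm
  · -- support inside `S`
    have hSπ : ∀ y ∈ S, π y ∈ S := fun y hy => by
      rw [hπ_def, Perm.mul_apply]; exact (hS _ (hS y hy).2).1
    have hSπ' : ∀ y ∈ S, π⁻¹ y ∈ S := fun y hy => by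
      rw [hπ_def, mul_inv_rev, hσinv, hτinv, Perm.mul_apply]; exact (hS _ (hS y hy).1).2
    have hzpow : ∀ (t : ℤ) (y : α), y ∈ S → (π ^ t) y ∈ S := fun t => by
      induction t with
      | zero => intro y hy; simpa using hy
      | succ k ih => intro y hy; rw [zpow_add_one, Perm.mul_apply]; exact ih _ (hSπ y hy)
      | pred k ih => intro y hy; rw [zpow_sub_one, Perm.mul_apply]; exact ih _ (hSπ' y hy)
    intro y hy
    rw [hr] at hy
    rcases cases3 y with ⟨t, rfl⟩ | ⟨t, rfl⟩ | ⟨h, h'⟩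
    · exact hzpow t v₀ hv₀
    · exact hzpow t _ (hS v₀ hv₀).1
    · exact absurd (fC y h h') hy

/-- The three unordered pairs of distinct elements of `Fin 3`. [folklore] -/
theorem pair_cases_fin3 : ∀ p q : Fin 3, p ≠ q →
    ({p, q} : Finset (Fin 3)) = {0, 1} ∨ ({p, q} : Finset (Fin 3)) = {0, 2} ∨
      ({p, q} : Finset (Fin 3)) = {1, 2} := by
  decide

end AltCycleSupply

open AltCycleSupply in
/-- **Alternating-cycle supply of local triples** (crux `SnSubsetDichotomy.HyperoctahedralSubsets`,
stmt-MatrixMultiplication-8305, line `spherical-rank-sieve`).  Let `μ 0, μ 1, μ 2` be fixed-point-free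
involutions of `Fin n`, `i ≠ j`, and `S 0, …, S (g-1)` pairwise-disjoint non-empty sets each closed
under `μ i` and `μ j` (e.g. `g` components of the 2-factor `M_i ∪ M_j`).  Then there are `g`
SUPPORT-DISJOINT COMMUTING LOCAL TRIPLES `(a l, b l)` — commuting involutions, not both trivial,
`a l ∈ C(μ 0)`, `b l ∈ C(μ 1)`, `a l · b l ∈ C(μ 2)` — the `l`-th supported inside `S l`; this is
exactly the input of the landed bridge `stub_triplesToGroup`.  Proof: `exists_commuting_involution_on`
gives an involution `r l ≠ 1` commuting with `μ i`, `μ j` and supported in `S l`; take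
`(a l, b l) = (r l, r l)` if `{i, j} = {0, 1}`, `(r l, 1)` if `{i, j} = {0, 2}`, `(1, r l)` if
`{i, j} = {1, 2}`. [folklore] -/
theorem stub_altCycleSupply :
    ∀ (n : ℕ) (μ : Fin 3 → Equiv.Perm (Fin n)), (∀ i, μ i * μ i = 1 ∧ ∀ v, μ i v ≠ v) →
    ∀ (i j : Fin 3), i ≠ j → ∀ (g : ℕ) (S : Fin g → Finset (Fin n)),
      (∀ l, (S l).Nonempty) → (∀ l, ∀ v ∈ S l, μ i v ∈ S l ∧ μ j v ∈ S l) →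
      (∀ l l', l ≠ l' → Disjoint (S l) (S l')) →
      ∃ (a b : Fin g → Equiv.Perm (Fin n)),
        (∀ l, a l * a l = 1 ∧ b l * b l = 1 ∧ a l * b l = b l * a l ∧ (a l ≠ 1 ∨ b l ≠ 1) ∧
          a l * μ 0 = μ 0 * a l ∧ b l * μ 1 = μ 1 * b l ∧ a l * b l * μ 2 = μ 2 * (a l * b l)) ∧
        (∀ l l' : Fin g, l ≠ l' → ∀ v, (a l v ≠ v ∨ b l v ≠ v) → a l' v = v ∧ b l' v = v) ∧
        (∀ l v, (a l v ≠ v ∨ b l v ≠ v) → v ∈ S l) := by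
  intro n μ hμ i j hij g S hne hS hdisj
  -- one commuting involution per set
  have hr : ∀ l, ∃ r : Equiv.Perm (Fin n), r * r = 1 ∧ r ≠ 1 ∧ r * μ i = μ i * r ∧
      r * μ j = μ j * r ∧ ∀ v, r v ≠ v → v ∈ S l := fun l =>
    exists_commuting_involution_on (μ i) (μ j) (hμ i).1 (hμ j).1 (hμ i).2 (hμ j).2 (S l) (hS l)
      (hne l)
  choose r hrr hr1 hri hrj hrS using hr
  -- support-disjointness from the disjointness of the `S l`
  have hfix : ∀ l l' : Fin g, l ≠ l' → ∀ v, r l v ≠ v → r l' v = v := fun l l' hll' v hv => by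
    by_contra h
    exact Finset.disjoint_left.1 (hdisj l l' hll') (hrS l v hv) (hrS l' v h)
  have one_comm : ∀ c : Fin 3, (1 : Equiv.Perm (Fin n)) * μ c = μ c * 1 := fun c => by
    rw [one_mul, mul_one]
  -- the role assignment, by cases on the pair `(i, j)`
  have main : ∀ (p q : Fin 3), p ≠ q → (∀ l, r l * μ p = μ p * r l) → (∀ l, r l * μ q = μ q * r l) →
      ∃ (a b : Fin g → Equiv.Perm (Fin n)),
        (∀ l, a l * a l = 1 ∧ b l * b l = 1 ∧ a l * b l = b l * a l ∧ (a l ≠ 1 ∨ b l ≠ 1) ∧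
          a l * μ 0 = μ 0 * a l ∧ b l * μ 1 = μ 1 * b l ∧ a l * b l * μ 2 = μ 2 * (a l * b l)) ∧
        (∀ l l' : Fin g, l ≠ l' → ∀ v, (a l v ≠ v ∨ b l v ≠ v) → a l' v = v ∧ b l' v = v) ∧
        (∀ l v, (a l v ≠ v ∨ b l v ≠ v) → v ∈ S l) := by
    intro p q hpq hp hq
    -- the three unordered pairs; `(p, q)` and `(q, p)` are treated alike
    have H01 : ({p, q} : Finset (Fin 3)) = {0, 1} →
        ∃ (a b : Fin g → Equiv.Perm (Fin n)),
        (∀ l, a l * a l = 1 ∧ b l * b l = 1 ∧ a l * b l = b l * a l ∧ (a l ≠ 1 ∨ b l ≠ 1) ∧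
          a l * μ 0 = μ 0 * a l ∧ b l * μ 1 = μ 1 * b l ∧ a l * b l * μ 2 = μ 2 * (a l * b l)) ∧
        (∀ l l' : Fin g, l ≠ l' → ∀ v, (a l v ≠ v ∨ b l v ≠ v) → a l' v = v ∧ b l' v = v) ∧
        (∀ l v, (a l v ≠ v ∨ b l v ≠ v) → v ∈ S l) := by
      intro h
      have h0 : ∀ l, r l * μ 0 = μ 0 * r l := by
        have : (0 : Fin 3) ∈ ({p, q} : Finset (Fin 3)) := by rw [h]; simp
        simp only [Finset.mem_insert, Finset.mem_singleton] at this
        rcases this with e | e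
        · exact fun l => e ▸ hp l
        · exact fun l => e ▸ hq l
      have h1 : ∀ l, r l * μ 1 = μ 1 * r l := by
        have : (1 : Fin 3) ∈ ({p, q} : Finset (Fin 3)) := by rw [h]; simp
        simp only [Finset.mem_insert, Finset.mem_singleton] at this
        rcases this with e | e
        · exact fun l => e ▸ hp l
        · exact fun l => e ▸ hq l
      refine ⟨r, r, fun l => ⟨hrr l, hrr l, rfl, Or.inl (hr1 l), h0 l, h1 l, ?_⟩, ?_, ?_⟩
      · rw [hrr l, one_mul, mul_one]
      · intro l l' hll' v hv
        have hv' : r l v ≠ v := by rcases hv with hv | hv <;> exact hv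
        exact ⟨hfix l l' hll' v hv', hfix l l' hll' v hv'⟩
      · intro l v hv
        have hv' : r l v ≠ v := by rcases hv with hv | hv <;> exact hv
        exact hrS l v hv'
    have H02 : ({p, q} : Finset (Fin 3)) = {0, 2} →
        ∃ (a b : Fin g → Equiv.Perm (Fin n)),
        (∀ l, a l * a l = 1 ∧ b l * b l = 1 ∧ a l * b l = b l * a l ∧ (a l ≠ 1 ∨ b l ≠ 1) ∧
          a l * μ 0 = μ 0 * a l ∧ b l * μ 1 = μ 1 * b l ∧ a l * b l * μ 2 = μ 2 * (a l * b l)) ∧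
        (∀ l l' : Fin g, l ≠ l' → ∀ v, (a l v ≠ v ∨ b l v ≠ v) → a l' v = v ∧ b l' v = v) ∧
        (∀ l v, (a l v ≠ v ∨ b l v ≠ v) → v ∈ S l) := by
      intro h
      have h0 : ∀ l, r l * μ 0 = μ 0 * r l := by
        have : (0 : Fin 3) ∈ ({p, q} : Finset (Fin 3)) := by rw [h]; simp
        simp only [Finset.mem_insert, Finset.mem_singleton] at this
        rcases this with e | e
        · exact fun l => e ▸ hp l
        · exact fun l => e ▸ hq l
      have h2 : ∀ l, r l * μ 2 = μ 2 * r l := by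
        have : (2 : Fin 3) ∈ ({p, q} : Finset (Fin 3)) := by rw [h]; simp
        simp only [Finset.mem_insert, Finset.mem_singleton] at this
        rcases this with e | e
        · exact fun l => e ▸ hp l
        · exact fun l => e ▸ hq l
      refine ⟨r, fun _ => 1, fun l => ⟨hrr l, one_mul 1, ?_, Or.inl (hr1 l), h0 l, one_comm 1, ?_⟩,
        ?_, ?_⟩
      · rw [mul_one, one_mul]
      · rw [mul_one]; exact h2 l
      · intro l l' hll' v hv
        have hv' : r l v ≠ v := by
          rcases hv with hv | hv
          · exact hv
          · exact absurd (Perm.one_apply v) hv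
        exact ⟨hfix l l' hll' v hv', Perm.one_apply v⟩
      · intro l v hv
        have hv' : r l v ≠ v := by
          rcases hv with hv | hv
          · exact hv
          · exact absurd (Perm.one_apply v) hv
        exact hrS l v hv'
    have H12 : ({p, q} : Finset (Fin 3)) = {1, 2} →
        ∃ (a b : Fin g → Equiv.Perm (Fin n)),
        (∀ l, a l * a l = 1 ∧ b l * b l = 1 ∧ a l * b l = b l * a l ∧ (a l ≠ 1 ∨ b l ≠ 1) ∧
          a l * μ 0 = μ 0 * a l ∧ b l * μ 1 = μ 1 * b l ∧ a l * b l * μ 2 = μ 2 * (a l * b l)) ∧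
        (∀ l l' : Fin g, l ≠ l' → ∀ v, (a l v ≠ v ∨ b l v ≠ v) → a l' v = v ∧ b l' v = v) ∧
        (∀ l v, (a l v ≠ v ∨ b l v ≠ v) → v ∈ S l) := by
      intro h
      have h1 : ∀ l, r l * μ 1 = μ 1 * r l := by
        have : (1 : Fin 3) ∈ ({p, q} : Finset (Fin 3)) := by rw [h]; simp
        simp only [Finset.mem_insert, Finset.mem_singleton] at this
        rcases this with e | e
        · exact fun l => e ▸ hp l
        · exact fun l => e ▸ hq l
      have h2 : ∀ l, r l * μ 2 = μ 2 * r l := by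
        have : (2 : Fin 3) ∈ ({p, q} : Finset (Fin 3)) := by rw [h]; simp
        simp only [Finset.mem_insert, Finset.mem_singleton] at this
        rcases this with e | e
        · exact fun l => e ▸ hp l
        · exact fun l => e ▸ hq l
      refine ⟨fun _ => 1, r, fun l => ⟨one_mul 1, hrr l, ?_, Or.inr (hr1 l), one_comm 0, h1 l, ?_⟩,
        ?_, ?_⟩
      · rw [mul_one, one_mul]
      · rw [one_mul]; exact h2 l
      · intro l l' hll' v hv
        have hv' : r l v ≠ v := by
          rcases hv with hv | hv
          · exact absurd (Perm.one_apply v) hv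
          · exact hv
        exact ⟨Perm.one_apply v, hfix l l' hll' v hv'⟩
      · intro l v hv
        have hv' : r l v ≠ v := by
          rcases hv with hv | hv
          · exact absurd (Perm.one_apply v) hv
          · exact hv
        exact hrS l v hv'
    -- which pair is it?
    rcases pair_cases_fin3 p q hpq with h | h | h
    · exact H01 h
    · exact H02 h
    · exact H12 h
  exact main i j hij hri hrj

end Summit.MatrixMultiplication.MatrixMultiplication.Theorems.HyperoctahedralSubsets
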